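import Summits.QuantumFields.BalabanUV.T4Continuum.Support.CovariantDivergencePlanting
import Summits.QuantumFields.BalabanUV.T4Continuum.Support.ScalarBlockPlanting

/-!
# T⁴ programme, spine node NE2 (U1a) — THE SANDWICHED COVARIANT-DIVERGENCE PLANTING DATUM, BOUNDS (tier B, supplier row B4.f of
# `t4/formal/NE2/LEAVES.md`; companion of `Support/CovariantDivergencePlanting`)

NE2 formalisation swarm `t4-ne2-formalise-*`, seat LEAF 10 (unit `b2b-balaban-t4-ne2-formalise-leaf-10`), fourth file.  File 3 typed the
planting defect of the covariant divergence at two levels `η = 1/N`, `η′ = η/R`, `Θ = D′_Rᴴ·(J ⊗ 1) − (J⁰ ⊗ 1)·D_Rᴴ` (`J⁰` King's pairing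
on 0-forms), and proved the EXACT SPLIT `Θ = ((1 − Π₀′) ⊗ 1)·Y + W` (`divPlant_eq`): the free part `Y = Y⁰ ⊗ 1`,
`Y⁰ = Σ_μ injM′_μᴴ(∇′_μᴴJ − J∇_μᴴ)`, carries the scalar block-complement projection `1 − Π₀′`; the connection part
`W = Σ_μ (injM′_μᴴ ⊗ 1)[(S′_μᴴ ⊗ 1)·siteMul(w̄′_μ − w̄_μ∘parT)·(J ⊗ 1) + ((S′_μᴴ(1 − F_μ)J(1 − S_μᴴ)) ⊗ 1)·siteMul(w̄_μ)]`.  Here, through the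
coarse vector propagator `𝒢 = calG N ⊗ 1` ([Balaban1984PropagatorsI] Prop. 1.1 (1.89), tree theorems):

 * §0 BRIDGES to row B4.d's vocabulary (`Support/ScalarBlockPlanting`, leaf-04, landed independently the same hour): `injM = emb` (rfl),
   `JK0 = ScalarBlockPlanting.JK0`, `Pi0 = ScalarBlockPlanting.Pi0` — the same objects, so B4.b may mix both files' lemmas;
 * §1 `‖∇_μᴴ𝒢‖ ≤ Cst`, `S_μ∇_μᴴ = −∇_μ`, `1 − S_μᴴ = N⁻¹·S_μᴴ∇_μ`; **`opNorm_YfreeS_mul_calG_le`** `‖Y⁰·𝒢‖ ≤ d(R + 1)Cst`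
   (`∇′ᴴJ𝒢 = R·S′ᴴFJ(S∇ᴴ𝒢)`), lifted `‖Y·(𝒢 ⊗ 1)‖ ≤ d(R + 1)Cst`;
 * §1 **`opNorm_WpartDir_mul_le`** / **`opNorm_Wpart_mul_le`**: `‖W·(𝒢 ⊗ 1)‖ ≤ d(β′ + 2(α + β))Cst/N` from the two-level consistency
   `‖w′(x′) − w(parT x′)‖ ≤ β′/N` of the connection at the block parent (THE B6 / NE3 CURRENCY), its size `α` and lattice-Lipschitz
   constant `β/N` (colour Leibniz) — the `1/N` is the backward coarse difference; NO complement law enters this part;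
 * §1 the END **`opNorm_sandwiched_divPlant_le`**: for ANY left factor `Gs` (DATA: the perturbed scalar resolvent `G′_{U,k+1}` of row
   B4.b) with `‖Gs‖ ≤ g` and complement law `‖Gs·((1 − Π₀′) ⊗ 1)‖ ≤ c₀`,
   `‖Gs·Θ·(𝒢 ⊗ 1)‖ ≤ c₀·d(R + 1)Cst + g·d(β′ + 2(α + β))Cst/N` — with `c₀ = O(L^{−k})` (rows B4.d/B4.e) and `1/N = L^{−k}` this is the
   geometric `ζ`-type input of `GaugeTermSandwichLaw.SandwichLaws`; and **`opNorm_covGradH_mul_calG_le`** `‖D_Rᴴ·(𝒢 ⊗ 1)‖ ≤ dCst + dαCst`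
   for the second piece `(Q′_{k+1}G′_{k+1}J⁰_k − Q′_kG′_k)·D_Rᴴ` of `Z_{k+1}J_k − Z_k`.

HONEST FRAMING (T4-DAG p. 1).  [folklore] operator-norm bookkeeping OURS; the only printed input is (1.89) through the tree's kernel
theorems; transporters and `Gs` are DATA (trigger c5); finite torus, linear layer, operator norm, model level; NOT [B9] (3.23)–(3.26) as
printed; NE2 NOT proved; NOT infinite volume / mass gap / Clay / summit progress; spine 0/9 unchanged.  HONEST DEPENDENCY: continuum YM on T⁴
⇐ BetaPertH ∧ nine spine estimates (0/9 proved); BetaPertH ⇐ (D1) ∧ (D4) ∧ CAP+tail; G-an2-4 gates asym, D1 and NE2/3/4.  ABSOLUTE RULE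
kept; no `sorry`.
-/

noncomputable section

open scoped BigOperators ComplexConjugate Matrix Matrix.Norms.L2Operator Kronecker

namespace Summit.QuantumFields.BalabanUV.T4Continuum.CovariantDivergencePlantingBound

open Literature.MathematicalPhysics.QuantumFieldTheory.Balaban1983to89.B5Prop11Plancherel
open Summit.QuantumFields.BalabanUV.T4Continuum
open Summit.QuantumFields.BalabanUV.T4Continuum.KingPairingPlantedLaw (JK opNorm_JK_le)
open Summit.QuantumFields.BalabanUV.T4Continuum.BlockPairingGeometry (tau parT faceF opNorm_shiftM_le)
open Summit.QuantumFields.BalabanUV.T4Continuum.BlockPairingFaces (opNorm_faceF_le opNorm_calG_mul_fdiff_le)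
open Summit.QuantumFields.BalabanUV.T4Continuum.FirstOrderAdjointModel (conjTranspose_fdiff_eq conjTranspose_fdiff_mul_JK
  shiftM_mul_conjTranspose)
open Summit.QuantumFields.BalabanUV.T4Continuum.KroneckerLift
open Summit.QuantumFields.BalabanUV.T4Continuum.BlockMultiplication
open Summit.QuantumFields.BalabanUV.T4Continuum.KroneckerUnits
open Summit.QuantumFields.BalabanUV.T4Continuum.GaugeTermDecomposition
open Summit.QuantumFields.BalabanUV.T4Continuum.GaugeTermSandwichBound
open Summit.QuantumFields.BalabanUV.T4Continuum.CovariantDivergencePlanting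

variable {d : ℕ}

/-! ## §0 Bridges to row B4.d's vocabulary -/

section Bridge

variable (N R : ℕ) [NeZero N] [NeZero R] (M : Fin d → ℕ) [hM : ∀ μ, NeZero (M μ)]

omit hM in
/-- the component injection of `GaugeTermDecomposition` IS the component embedding of `ScalarBlockPlanting`. [folklore] -/
theorem injM_eq_emb (Nf : Fin d → ℕ) [∀ μ, NeZero (Nf μ)] (μ : Fin d) : injM Nf μ = ScalarBlockPlanting.emb Nf μ := rfl

omit [NeZero N] [NeZero R] hM in
/-- the scalar King pairing of `CovariantDivergencePlanting` IS the planting `J₀ = √(R^d)·Q₀ᴴ` of `ScalarBlockPlanting`. [folklore] -/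
theorem JK0_eq_planting : JK0 N R M = ScalarBlockPlanting.JK0 N R M := by
  ext x y
  rw [ScalarBlockPlanting.JK0, Matrix.smul_apply, Matrix.conjTranspose_apply, ScalarBlockPlanting.star_Qavg0_apply]
  simp only [JK0, ScalarBlockPlanting.Qavg0, smul_eq_mul]
  split_ifs <;> simp

omit [NeZero R] in
/-- … and so are the block-mean projectors. [folklore] -/
theorem Pi0_eq_planting : Pi0 N R M = ScalarBlockPlanting.Pi0 N R M := by
  rw [Pi0, JK0_eq_planting, ScalarBlockPlanting.JK0_mul_conjTranspose]

end Bridge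

/-! ## §1 Bounds through the coarse vector propagator -/

section Bounds

variable (N R : ℕ) [NeZero N] [NeZero R] (M : Fin d → ℕ) [hM : ∀ μ, NeZero (M μ)] (a : ℝ) (ha : 0 < a)
  {o : Type*} [Fintype o] [DecidableEq o]

/-- `‖∇_μᴴ𝒢‖ ≤ Cst` (from the tree's `‖𝒢∇_μ‖ ≤ Cst` and `𝒢ᴴ = 𝒢`). [cite: Balaban1984PropagatorsI, Prop. 1.1 (1.89) p.33] [folklore] -/
theorem opNorm_fdiffH_mul_calG_le (hN : 1 ≤ N) (μ : Fin d) : ‖(fdiff (fine N M) ((N : ℕ) : ℂ) μ)ᴴ * calG N hN M a ha‖ ≤ Cst d a := by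
  have e : (fdiff (fine N M) ((N : ℕ) : ℂ) μ)ᴴ * calG N hN M a ha = (calG N hN M a ha * fdiff (fine N M) ((N : ℕ) : ℂ) μ)ᴴ := by
    rw [Matrix.conjTranspose_mul, (calG_isHermitian N hN M a ha).eq]
  rw [e, Matrix.l2_opNorm_conjTranspose]; exact opNorm_calG_mul_fdiff_le N M a ha hN μ

/-- `S_μ∇_μᴴ = −∇_μ` (real lattice factor). [folklore] -/
theorem shiftM_mul_fdiffH (μ : Fin d) :
    shiftM (fine N M) μ * (fdiff (fine N M) ((N : ℕ) : ℂ) μ)ᴴ = -fdiff (fine N M) ((N : ℕ) : ℂ) μ := by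
  rw [conjTranspose_fdiff_eq N M μ, Matrix.mul_neg, ← Matrix.mul_assoc, shiftM_mul_conjTranspose, Matrix.one_mul]

/-- `1 − S_μᴴ = N⁻¹·(S_μᴴ∇_μ)` (a backward coarse difference). [folklore] -/
theorem one_sub_shiftH_eq_smul (hN : 1 ≤ N) (μ : Fin d) :
    (1 : Matrix (Tor (fine N M) × Fin d) (Tor (fine N M) × Fin d) ℂ) - (shiftM (fine N M) μ)ᴴ
      = (((N : ℕ) : ℂ))⁻¹ • ((shiftM (fine N M) μ)ᴴ * fdiff (fine N M) ((N : ℕ) : ℂ) μ) := by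
  have hNc : ((N : ℕ) : ℂ) ≠ 0 := by exact_mod_cast (Nat.pos_iff_ne_zero.mp hN)
  have h : (shiftM (fine N M) μ)ᴴ * fdiff (fine N M) ((N : ℕ) : ℂ) μ = ((N : ℕ) : ℂ) • (1 - (shiftM (fine N M) μ)ᴴ) := by
    rw [fdiff, Matrix.mul_smul, Matrix.mul_sub, Matrix.mul_one, BlockPairingGeometry.conjTranspose_shiftM_mul]
  rw [h, smul_smul, inv_mul_cancel₀ hNc, one_smul]

/-- **`‖Y⁰·𝒢‖ ≤ d(R + 1)Cst`**: `∇′ᴴJ𝒢 = R·S′ᴴFJ(S∇ᴴ𝒢)` with `S∇ᴴ𝒢 = −∇𝒢`, and `‖J∇ᴴ𝒢‖ ≤ Cst`.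
[cite: Balaban1984PropagatorsI, Prop. 1.1 (1.89) p.33; King1986, (2.10) p.653] [folklore] -/
theorem opNorm_YfreeS_mul_calG_le (hN : 1 ≤ N) : ‖YfreeS N R M * calG N hN M a ha‖ ≤ d * ((R : ℝ) + 1) * Cst d a := by
  have hC := Cst_nonneg d a
  set G := calG N hN M a ha with hG
  rw [YfreeS, Matrix.sum_mul]
  refine (norm_sum_le _ _).trans ?_
  have hterm : ∀ μ ∈ Finset.univ, ‖(injM (fine (R * N) M) μ)ᴴ * ((fdiff (fine (R * N) M) (((R * N : ℕ)) : ℂ) μ)ᴴ * JK N R M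
      - JK N R M * (fdiff (fine N M) ((N : ℕ) : ℂ) μ)ᴴ) * G‖ ≤ ((R : ℝ) + 1) * Cst d a := by
    intro μ _
    rw [Matrix.mul_assoc, Matrix.sub_mul]
    have h1 : ‖(fdiff (fine (R * N) M) (((R * N : ℕ)) : ℂ) μ)ᴴ * JK N R M * G‖ ≤ R * Cst d a := by
      rw [conjTranspose_fdiff_mul_JK N R M hN μ, Matrix.smul_mul, norm_smul, Complex.norm_natCast, Matrix.mul_assoc _ ((fdiff (fine N M) _ μ)ᴴ) G,
        Matrix.mul_assoc _ (shiftM (fine N M) μ), ← Matrix.mul_assoc (shiftM (fine N M) μ), shiftM_mul_fdiffH, Matrix.neg_mul, Matrix.mul_neg, norm_neg]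
      refine mul_le_mul_of_nonneg_left ?_ (Nat.cast_nonneg R)
      have hA : ‖(shiftM (fine (R * N) M) μ)ᴴ * faceF N R M μ * JK N R M‖ ≤ 1 :=
        (Matrix.l2_opNorm_mul _ _).trans ((mul_le_mul ((Matrix.l2_opNorm_mul _ _).trans ((mul_le_mul
          (by rw [Matrix.l2_opNorm_conjTranspose]; exact opNorm_shiftM_le _ μ) (opNorm_faceF_le N R M μ) (norm_nonneg _) zero_le_one).trans
          (le_of_eq (one_mul 1)))) (opNorm_JK_le N R M) (norm_nonneg _) zero_le_one).trans (le_of_eq (one_mul 1)))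
      calc _ ≤ ‖(shiftM (fine (R * N) M) μ)ᴴ * faceF N R M μ * JK N R M‖ * ‖fdiff (fine N M) ((N : ℕ) : ℂ) μ * G‖ := Matrix.l2_opNorm_mul _ _
        _ ≤ 1 * Cst d a := mul_le_mul hA (opNorm_fdiff_calG_le N hN M a ha μ) (norm_nonneg _) zero_le_one
        _ = Cst d a := one_mul _
    have h2 : ‖JK N R M * (fdiff (fine N M) ((N : ℕ) : ℂ) μ)ᴴ * G‖ ≤ Cst d a := by
      rw [Matrix.mul_assoc]
      calc _ ≤ ‖JK N R M‖ * ‖(fdiff (fine N M) ((N : ℕ) : ℂ) μ)ᴴ * G‖ := Matrix.l2_opNorm_mul _ _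
        _ ≤ 1 * Cst d a := mul_le_mul (opNorm_JK_le N R M) (opNorm_fdiffH_mul_calG_le N M a ha hN μ) (norm_nonneg _) zero_le_one
        _ = Cst d a := one_mul _
    calc _ ≤ ‖(injM (fine (R * N) M) μ)ᴴ‖ * ‖(fdiff (fine (R * N) M) (((R * N : ℕ)) : ℂ) μ)ᴴ * JK N R M * G
            - JK N R M * (fdiff (fine N M) ((N : ℕ) : ℂ) μ)ᴴ * G‖ := Matrix.l2_opNorm_mul _ _
      _ ≤ 1 * (R * Cst d a + Cst d a) :=
          mul_le_mul (opNorm_injM_conjTranspose_le _ μ) ((norm_sub_le _ _).trans (add_le_add h1 h2)) (norm_nonneg _) zero_le_one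
      _ = ((R : ℝ) + 1) * Cst d a := by ring
  refine (Finset.sum_le_sum hterm).trans (le_of_eq ?_)
  rw [Finset.sum_const, Finset.card_univ, Fintype.card_fin, nsmul_eq_mul, mul_assoc]

/-- the free part, lifted: `‖Y·(𝒢 ⊗ 1)‖ ≤ d(R + 1)Cst`. [folklore] -/
theorem opNorm_Yfree_mul_le (hN : 1 ≤ N) :
    ‖Yfree N R M o * (calG N hN M a ha ⊗ₖ (1 : Matrix o o ℂ))‖ ≤ d * ((R : ℝ) + 1) * Cst d a := by
  rw [Yfree, ← kron_mul]; exact opNorm_kron_le_of_le o (opNorm_YfreeS_mul_calG_le N R M a ha hN)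

/-- **the connection part, per direction**: `‖W_μ·(𝒢 ⊗ 1)‖ ≤ (β′ + 2(α + β))·Cst/N` from the two-level consistency `β′/N` at the block
parent, the size `α` and the Lipschitz constant `β/N` of the coarse connection (colour Leibniz; the `1/N` is the backward coarse
difference `1 − Sᴴ = N⁻¹Sᴴ∇`). [cite: Balaban1984PropagatorsI, Prop. 1.1 (1.89) p.33, (1.31) p.23] [folklore] -/
theorem opNorm_WpartDir_mul_le (hN : 1 ≤ N) {R₁ : Fin d → (Tor (fine (R * N) M) → Matrix o o ℂ)}
    {R₀ : Fin d → (Tor (fine N M) → Matrix o o ℂ)} {α β β' : ℝ} (hα : 0 ≤ α) (hβ : 0 ≤ β) (hβ' : 0 ≤ β') (μ : Fin d)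
    (hR : ∀ i, ‖connL (fine N M) ((N : ℕ) : ℂ) R₀ μ i‖ ≤ α)
    (hLip : ∀ lam i, ‖connL (fine N M) ((N : ℕ) : ℂ) R₀ μ (tau (fine N M) lam i) - connL (fine N M) ((N : ℕ) : ℂ) R₀ μ i‖ ≤ β / N)
    (hcons : ∀ i', ‖connL (fine (R * N) M) (((R * N : ℕ)) : ℂ) R₁ μ i' - connL (fine N M) ((N : ℕ) : ℂ) R₀ μ (parT N R M i')‖ ≤ β' / N) :
    ‖WpartDir N R M R₁ R₀ μ * (calG N hN M a ha ⊗ₖ (1 : Matrix o o ℂ))‖ ≤ (β' + 2 * (α + β)) * Cst d a / N := by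
  have hNpos : (0 : ℝ) < N := by exact_mod_cast hN
  have hC := Cst_nonneg d a
  set c : ℂ := ((N : ℕ) : ℂ) with hc
  set G := calG N hN M a ha ⊗ₖ (1 : Matrix o o ℂ) with hG
  set w : Tor (fine N M) × Fin d → Matrix o o ℂ := fun i => (connL (fine N M) c R₀ μ i)ᴴ with hw
  have hG0 : ‖G‖ ≤ Cst d a := opNorm_kron_le_of_le o (opNorm_calG_le N hN M a ha)
  -- T1: the two-level consistency term
  have hT1 : ‖(shiftM (fine (R * N) M) μ)ᴴ ⊗ₖ (1 : Matrix o o ℂ)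
      * siteMul (fun i' => (connL (fine (R * N) M) (((R * N : ℕ)) : ℂ) R₁ μ i')ᴴ - (connL (fine N M) c R₀ μ (parT N R M i'))ᴴ)
      * (JK N R M ⊗ₖ (1 : Matrix o o ℂ)) * G‖ ≤ β' / N * Cst d a := by
    have hD : ‖siteMul (fun i' => (connL (fine (R * N) M) (((R * N : ℕ)) : ℂ) R₁ μ i')ᴴ - (connL (fine N M) c R₀ μ (parT N R M i'))ᴴ)‖ ≤ β' / N := by
      refine opNorm_siteMul_le _ (by positivity) fun i' => ?_
      rw [← Matrix.conjTranspose_sub, Matrix.l2_opNorm_conjTranspose]; exact hcons i'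
    calc _ ≤ ‖(shiftM (fine (R * N) M) μ)ᴴ ⊗ₖ (1 : Matrix o o ℂ)
              * siteMul (fun i' => (connL (fine (R * N) M) (((R * N : ℕ)) : ℂ) R₁ μ i')ᴴ - (connL (fine N M) c R₀ μ (parT N R M i'))ᴴ)
              * (JK N R M ⊗ₖ (1 : Matrix o o ℂ))‖ * ‖G‖ := Matrix.l2_opNorm_mul _ _
      _ ≤ ((1 * (β' / N)) * 1) * Cst d a := by
          refine mul_le_mul ((Matrix.l2_opNorm_mul _ _).trans (mul_le_mul ((Matrix.l2_opNorm_mul _ _).trans (mul_le_mul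
            (opNorm_kron_le_of_le o (by rw [Matrix.l2_opNorm_conjTranspose]; exact opNorm_shiftM_le _ μ)) hD (norm_nonneg _) zero_le_one))
            (opNorm_kron_le_of_le o (opNorm_JK_le N R M)) (norm_nonneg _) (by positivity))) hG0 (norm_nonneg _) (by positivity)
      _ = β' / N * Cst d a := by ring
  -- T2: the backward-shift planting term
  have hLeib : ‖fdiff (fine N M) c μ ⊗ₖ (1 : Matrix o o ℂ) * siteMul w * G‖ ≤ (α + β) * Cst d a := by
    rw [kronFdiff_mul_siteMul, Matrix.add_mul, Matrix.smul_mul]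
    have hwt : ∀ i, ‖(w ∘ tau (fine N M) μ) i‖ ≤ α := fun i => by
      simp only [Function.comp_apply, hw, Matrix.l2_opNorm_conjTranspose]; exact hR _
    have hp1 : ‖siteMul (w ∘ tau (fine N M) μ) * fdiff (fine N M) c μ ⊗ₖ (1 : Matrix o o ℂ) * G‖ ≤ α * Cst d a := by
      rw [Matrix.mul_assoc]
      refine (Matrix.l2_opNorm_mul _ _).trans (mul_le_mul (opNorm_siteMul_le _ hα hwt) ?_ (norm_nonneg _) hα)
      rw [hG, ← kron_mul]; exact opNorm_kron_le_of_le o (opNorm_fdiff_calG_le N hN M a ha μ)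
    have hdiff : ‖siteMul (w ∘ tau (fine N M) μ) - siteMul w‖ ≤ β / N := by
      rw [← siteMul_sub]
      refine opNorm_siteMul_le _ (by positivity) fun i => ?_
      simp only [Function.comp_apply, hw, ← Matrix.conjTranspose_sub, Matrix.l2_opNorm_conjTranspose]
      exact hLip μ i
    have hp2 : ‖c • ((siteMul (w ∘ tau (fine N M) μ) - siteMul w) * G)‖ ≤ β * Cst d a := by
      rw [norm_smul, hc, Complex.norm_natCast]
      calc (N : ℝ) * ‖(siteMul (w ∘ tau (fine N M) μ) - siteMul w) * G‖ ≤ N * (β / N * Cst d a) :=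
            mul_le_mul_of_nonneg_left ((Matrix.l2_opNorm_mul _ _).trans (mul_le_mul hdiff hG0 (norm_nonneg _) (by positivity))) hNpos.le
        _ = β * Cst d a := by field_simp
    calc _ ≤ ‖siteMul (w ∘ tau (fine N M) μ) * fdiff (fine N M) c μ ⊗ₖ (1 : Matrix o o ℂ) * G‖
            + ‖c • ((siteMul (w ∘ tau (fine N M) μ) - siteMul w) * G)‖ := norm_add_le _ _
      _ ≤ α * Cst d a + β * Cst d a := add_le_add hp1 hp2
      _ = (α + β) * Cst d a := by ring
  have hT2 : ‖((shiftM (fine (R * N) M) μ)ᴴ * (1 - faceF N R M μ) * JK N R M * (1 - (shiftM (fine N M) μ)ᴴ)) ⊗ₖ (1 : Matrix o o ℂ)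
      * siteMul w * G‖ ≤ 2 * (α + β) * Cst d a / N := by
    have e : ((shiftM (fine (R * N) M) μ)ᴴ * (1 - faceF N R M μ) * JK N R M * (1 - (shiftM (fine N M) μ)ᴴ)) ⊗ₖ (1 : Matrix o o ℂ)
        * siteMul w * G
        = c⁻¹ • (((shiftM (fine (R * N) M) μ)ᴴ * (1 - faceF N R M μ) * JK N R M * (shiftM (fine N M) μ)ᴴ) ⊗ₖ (1 : Matrix o o ℂ)
          * (fdiff (fine N M) c μ ⊗ₖ (1 : Matrix o o ℂ) * siteMul w * G)) := by
      rw [one_sub_shiftH_eq_smul N M hN μ, ← hc, Matrix.mul_smul, Matrix.smul_kronecker, Matrix.smul_mul, Matrix.smul_mul,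
        ← Matrix.mul_assoc _ ((shiftM (fine N M) μ)ᴴ), kron_mul o _ (fdiff (fine N M) c μ)]
      simp only [Matrix.mul_assoc]
    rw [e, norm_smul, norm_inv, hc, Complex.norm_natCast]
    have hB : ‖((shiftM (fine (R * N) M) μ)ᴴ * (1 - faceF N R M μ) * JK N R M * (shiftM (fine N M) μ)ᴴ) ⊗ₖ (1 : Matrix o o ℂ)‖ ≤ 2 := by
      refine opNorm_kron_le_of_le o ?_
      have hF : ‖(1 : Matrix (Tor (fine (R * N) M) × Fin d) (Tor (fine (R * N) M) × Fin d) ℂ) - faceF N R M μ‖ ≤ 2 := by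
        refine (norm_sub_le _ _).trans ?_
        have h1 : ‖(1 : Matrix (Tor (fine (R * N) M) × Fin d) (Tor (fine (R * N) M) × Fin d) ℂ)‖ ≤ 1 := by
          rw [← Matrix.diagonal_one, Matrix.l2_opNorm_diagonal]
          exact (pi_norm_le_iff_of_nonneg zero_le_one).mpr fun _ => by simp
        linarith [opNorm_faceF_le N R M μ]
      calc _ ≤ ‖(shiftM (fine (R * N) M) μ)ᴴ * (1 - faceF N R M μ) * JK N R M‖ * ‖(shiftM (fine N M) μ)ᴴ‖ := Matrix.l2_opNorm_mul _ _
        _ ≤ ((1 * 2) * 1) * 1 := by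
            refine mul_le_mul ((Matrix.l2_opNorm_mul _ _).trans (mul_le_mul ((Matrix.l2_opNorm_mul _ _).trans (mul_le_mul
              (by rw [Matrix.l2_opNorm_conjTranspose]; exact opNorm_shiftM_le _ μ) hF (norm_nonneg _) zero_le_one)) (opNorm_JK_le N R M)
              (norm_nonneg _) (by norm_num))) (by rw [Matrix.l2_opNorm_conjTranspose]; exact opNorm_shiftM_le _ μ) (norm_nonneg _) (by norm_num)
        _ = 2 := by norm_num
    calc (N : ℝ)⁻¹ * ‖((shiftM (fine (R * N) M) μ)ᴴ * (1 - faceF N R M μ) * JK N R M * (shiftM (fine N M) μ)ᴴ) ⊗ₖ (1 : Matrix o o ℂ)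
            * (fdiff (fine N M) c μ ⊗ₖ (1 : Matrix o o ℂ) * siteMul w * G)‖
        ≤ (N : ℝ)⁻¹ * (2 * ((α + β) * Cst d a)) := by
          refine mul_le_mul_of_nonneg_left ((Matrix.l2_opNorm_mul _ _).trans (mul_le_mul hB hLeib (norm_nonneg _) (by norm_num)))
            (inv_nonneg.mpr hNpos.le)
      _ = 2 * (α + β) * Cst d a / N := by field_simp
  -- assemble
  rw [WpartDir]
  have e5 : (fun i => (connL (fine N M) ((N : ℕ) : ℂ) R₀ μ i)ᴴ) = w := rfl
  rw [e5, Matrix.mul_assoc, Matrix.add_mul]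
  calc _ ≤ ‖(injM (fine (R * N) M) μ)ᴴ ⊗ₖ (1 : Matrix o o ℂ)‖ * ‖(shiftM (fine (R * N) M) μ)ᴴ ⊗ₖ (1 : Matrix o o ℂ)
            * siteMul (fun i' => (connL (fine (R * N) M) (((R * N : ℕ)) : ℂ) R₁ μ i')ᴴ - (connL (fine N M) c R₀ μ (parT N R M i'))ᴴ)
            * (JK N R M ⊗ₖ (1 : Matrix o o ℂ)) * G
          + ((shiftM (fine (R * N) M) μ)ᴴ * (1 - faceF N R M μ) * JK N R M * (1 - (shiftM (fine N M) μ)ᴴ)) ⊗ₖ (1 : Matrix o o ℂ)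
            * siteMul w * G‖ := Matrix.l2_opNorm_mul _ _
    _ ≤ 1 * (β' / N * Cst d a + 2 * (α + β) * Cst d a / N) :=
        mul_le_mul (opNorm_kron_le_of_le o (opNorm_injM_conjTranspose_le _ μ)) ((norm_add_le _ _).trans (add_le_add hT1 hT2))
          (norm_nonneg _) zero_le_one
    _ = (β' + 2 * (α + β)) * Cst d a / N := by ring

/-- the connection part: `‖W·(𝒢 ⊗ 1)‖ ≤ d(β′ + 2(α + β))Cst/N`. [folklore] -/
theorem opNorm_Wpart_mul_le (hN : 1 ≤ N) {R₁ : Fin d → (Tor (fine (R * N) M) → Matrix o o ℂ)}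
    {R₀ : Fin d → (Tor (fine N M) → Matrix o o ℂ)} {α β β' : ℝ} (hα : 0 ≤ α) (hβ : 0 ≤ β) (hβ' : 0 ≤ β')
    (hR : ∀ μ i, ‖connL (fine N M) ((N : ℕ) : ℂ) R₀ μ i‖ ≤ α)
    (hLip : ∀ μ lam i, ‖connL (fine N M) ((N : ℕ) : ℂ) R₀ μ (tau (fine N M) lam i) - connL (fine N M) ((N : ℕ) : ℂ) R₀ μ i‖ ≤ β / N)
    (hcons : ∀ μ i', ‖connL (fine (R * N) M) (((R * N : ℕ)) : ℂ) R₁ μ i' - connL (fine N M) ((N : ℕ) : ℂ) R₀ μ (parT N R M i')‖ ≤ β' / N) :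
    ‖Wpart N R M R₁ R₀ * (calG N hN M a ha ⊗ₖ (1 : Matrix o o ℂ))‖ ≤ d * ((β' + 2 * (α + β)) * Cst d a / N) := by
  rw [Wpart, Matrix.sum_mul]
  refine (norm_sum_le _ _).trans ?_
  refine (Finset.sum_le_sum fun μ _ => opNorm_WpartDir_mul_le N R M a ha hN hα hβ hβ' μ (hR μ) (hLip μ) (hcons μ)).trans (le_of_eq ?_)
  rw [Finset.sum_const, Finset.card_univ, Fintype.card_fin, nsmul_eq_mul]

/-- **THE SANDWICHED COVARIANT-DIVERGENCE PLANTING DATUM**: for ANY left factor `Gs` (the perturbed scalar resolvent of row B4.b, DATA)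
with `‖Gs‖ ≤ g` and the complement law `‖Gs·((1 − Π₀′) ⊗ 1)‖ ≤ c₀`,
`‖Gs·Θ·(𝒢 ⊗ 1)‖ ≤ c₀·d(R + 1)Cst + g·d(β′ + 2(α + β))Cst/N`. [cite: Balaban1984PropagatorsI, Prop. 1.1 (1.89) p.33; King1986, (2.10)
p.653] [folklore] -/
theorem opNorm_sandwiched_divPlant_le (hd : 1 ≤ d) (hN : 1 ≤ N) {R₁ : Fin d → (Tor (fine (R * N) M) → Matrix o o ℂ)}
    {R₀ : Fin d → (Tor (fine N M) → Matrix o o ℂ)} {α β β' g c₀ : ℝ} (hα : 0 ≤ α) (hβ : 0 ≤ β) (hβ' : 0 ≤ β') (hg : 0 ≤ g) (hc₀ : 0 ≤ c₀)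
    (hR : ∀ μ i, ‖connL (fine N M) ((N : ℕ) : ℂ) R₀ μ i‖ ≤ α)
    (hLip : ∀ μ lam i, ‖connL (fine N M) ((N : ℕ) : ℂ) R₀ μ (tau (fine N M) lam i) - connL (fine N M) ((N : ℕ) : ℂ) R₀ μ i‖ ≤ β / N)
    (hcons : ∀ μ i', ‖connL (fine (R * N) M) (((R * N : ℕ)) : ℂ) R₁ μ i' - connL (fine N M) ((N : ℕ) : ℂ) R₀ μ (parT N R M i')‖ ≤ β' / N)
    {γ' : Type*} [Fintype γ'] [DecidableEq γ'] {Gs : Matrix γ' (Tor (fine (R * N) M) × o) ℂ} (hGs : ‖Gs‖ ≤ g)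
    (hcomp : ‖Gs * ((1 - Pi0 N R M) ⊗ₖ (1 : Matrix o o ℂ))‖ ≤ c₀) :
    ‖Gs * divPlant N R M R₁ R₀ * (calG N hN M a ha ⊗ₖ (1 : Matrix o o ℂ))‖
      ≤ c₀ * (d * ((R : ℝ) + 1) * Cst d a) + g * (d * ((β' + 2 * (α + β)) * Cst d a / N)) := by
  rw [divPlant_eq N R M hd hN, Matrix.mul_add, Matrix.add_mul]
  refine (norm_add_le _ _).trans (add_le_add ?_ ?_)
  · rw [← Matrix.mul_assoc, Matrix.mul_assoc (Gs * _)]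
    exact (Matrix.l2_opNorm_mul _ _).trans (mul_le_mul hcomp (opNorm_Yfree_mul_le N R M a ha hN) (norm_nonneg _) hc₀)
  · rw [Matrix.mul_assoc]
    exact (Matrix.l2_opNorm_mul _ _).trans (mul_le_mul hGs (opNorm_Wpart_mul_le N R M a ha hN hα hβ hβ' hR hLip hcons) (norm_nonneg _) hg)

/-- for the second piece of `ζ`: **`‖D_Rᴴ·(𝒢 ⊗ 1)‖ ≤ d·Cst + d·α·Cst`** (free part by `GaugeTermSandwichBound.opNorm_gradH_mul_calG_le`,
defect by its size). [cite: Balaban1984PropagatorsI, Prop. 1.1 (1.89) p.33] [folklore] -/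
theorem opNorm_covGradH_mul_calG_le (hN : 1 ≤ N) {R₀ : Fin d → (Tor (fine N M) → Matrix o o ℂ)} {α : ℝ} (hα : 0 ≤ α)
    (hR : ∀ μ i, ‖connL (fine N M) ((N : ℕ) : ℂ) R₀ μ i‖ ≤ α) :
    ‖(covGrad (fine N M) ((N : ℕ) : ℂ) R₀)ᴴ * (calG N hN M a ha ⊗ₖ (1 : Matrix o o ℂ))‖ ≤ d * Cst d a + d * α * Cst d a := by
  rw [covGrad_eq, Matrix.conjTranspose_add, Matrix.add_mul]
  refine (norm_add_le _ _).trans (add_le_add ?_ ?_)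
  · rw [kron_conjTranspose, ← kron_mul]; exact opNorm_kron_le_of_le o (opNorm_gradH_mul_calG_le N hN M a ha)
  · exact (Matrix.l2_opNorm_mul _ _).trans (mul_le_mul (by rw [Matrix.l2_opNorm_conjTranspose]; exact opNorm_defect_le _ _ hα hR)
      (opNorm_kron_le_of_le o (opNorm_calG_le N hN M a ha)) (norm_nonneg _) (by positivity))

end Bounds

end Summit.QuantumFields.BalabanUV.T4Continuum.CovariantDivergencePlantingBound

end
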